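import Summits.CriticalPhenomena.SAWScalingLimit.Theorems.SAWLoopFugacityFlowAvoidanceLimitAnchorDefs

/-!
# The boundary Harnack chain of the edge-killed walk at a boundary point — definitions
(line `symplectic-fermion-anchor` of the crux `SAWLoopFugacityFlow.AvoidanceLimit`, stmt-CriticalPhenomena-10649;
lead c4 `prover-line-stmt-CriticalPhenomena-10649-c4-0`)

This file only DEFINES the finite lattice objects along which the uniform boundary Harnack principle
`stub_uniformBHP` (uniform BHP for the EDGE-killed `Ω_δ`-walk at a marked boundary point `p`, harmonicity
assumed only within `B(p, R)`) is iterated, following D. Chelkak, Y. Wan, Electron. J. Probab. 26 (2021)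
§3.2 (Lemma 3.7 / Cor. 3.8) with one change forced by the LOCAL harmonicity hypothesis: Chelkak–Wan's region
`Θ(r) = Ω ∖ Ω_o(b, r)` (vertices cut off from a base point `o` by the ball `B(b, r)`) is replaced by the set
of vertices that cannot reach distance `R` from `p` without entering `B(p, σ)` — which lies inside `B(p, R)`
BY DEFINITION (no "pockets are small" lemma is needed) — and the inner ball by the cluster of an anchor
vertex inside it. Nothing is asserted here.

* `FarEscape H δ p R σ v` — from `v` there is an `H`-walk reaching (mesh) distance `≥ R` from `p` all of
  whose vertices stay at distance `≥ σ` from `p`.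
* `farTheta H Λ δ p R σ` — the vertices of the volume `Λ` that can NOT far-escape (`⊆ B(p, R)`; contains
  `Λ ∩ B(p, σ)`).
* `farCluster H Λ δ p R σ a₀` — the vertices of `Λ` joined to the anchor `a₀` by an `H`-walk inside
  `farTheta` (the analogue of Chelkak–Wan's inner ball, pockets included).
* `chainS … σ a₀ = farCluster ∪ (its H-neighbours in Λ)` and `chainR … σ a₀` = the `Λ`-interior of
  `chainS` (every `H`-neighbour in `Λ` lies in `chainS`): the sets `S j`, `R j` fed, along radii
  `σ_j = σ₀ 2^{-j}`, to the lattice adapter `transitionHarmonic_crossDiff_iterate_exit`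
  (`Theorems/SAWLoopFugacityFlowAvoidanceLimitCrossDiffAdapter.lean`).
* `exitKernel H T u x = Σ_{w ∈ T, w ∼_H x} greenEntry H T u w` — `4 ×` the probability that the walk from
  `u` killed off `T` leaves `T` through `x` (the kernel of the exit representation
  `transitionHarmonic_eq_sum_greenEntry_mul`).

Sources: Chelkak–Wan 2021 §3.2 [ChelkakWan2021]; G. Lawler, *Intersections of random walks* (1991) §1.4–1.5
[Lawler1991] (exit / last-exit decompositions). Deliberately NOT here: any statement of the line.
-/

noncomputable section

open scoped BigOperators Classical
open Finset
open Literature.Probability.RandomPlanarGeometry Literature.Probability.LatticeModels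

namespace Summit.CriticalPhenomena.SAWScalingLimit.Theorems.AvoidanceLimit.Anchor

/-- **Far escape.** From the vertex `v` there is an `H`-walk to a vertex at (mesh) distance `≥ R` from `p`
all of whose vertices (including `v`) are at distance `≥ σ` from `p`: `v` reaches "far" avoiding the
ball `B(p, σ)`. -/
def FarEscape (H : SimpleGraph (Site 2)) (δ : ℝ) (p : ℂ) (R σ : ℝ) (v : Site 2) : Prop :=
  ∃ (y : Site 2) (w : H.Walk v y), R ≤ dist (meshPoint δ y) p ∧ ∀ z ∈ w.support, σ ≤ dist (meshPoint δ z) p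

/-- **`Θ(σ)`**: the vertices of the volume `Λ` that cannot far-escape (Chelkak–Wan's `Θ^δ(r)` with "reach the
base point `o`" replaced by "reach distance `R` from `p`"). -/
def farTheta (H : SimpleGraph (Site 2)) (Λ : Finset (Site 2)) (δ : ℝ) (p : ℂ) (R σ : ℝ) :
    Finset (Site 2) :=
  Λ.filter fun v => ¬ FarEscape H δ p R σ v

/-- **The anchored cluster**: the vertices of `Λ` joined to the anchor `a₀` by an `H`-walk all of whose
vertices lie in `farTheta` (the connected component of `a₀` in `Θ(σ)`; empty if `a₀ ∉ Θ(σ)`). -/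
def farCluster (H : SimpleGraph (Site 2)) (Λ : Finset (Site 2)) (δ : ℝ) (p : ℂ) (R σ : ℝ) (a₀ : Site 2) :
    Finset (Site 2) :=
  Λ.filter fun v => ∃ w : H.Walk a₀ v, ∀ z ∈ w.support, z ∈ farTheta H Λ δ p R σ

/-- **The chain set `S`**: the anchored cluster together with its `H`-neighbours in `Λ` (the cluster plus
its exit vertices). -/
def chainS (H : SimpleGraph (Site 2)) (Λ : Finset (Site 2)) (δ : ℝ) (p : ℂ) (R σ : ℝ) (a₀ : Site 2) :
    Finset (Site 2) :=
  Λ.filter fun x => x ∈ farCluster H Λ δ p R σ a₀ ∨ ∃ w ∈ farCluster H Λ δ p R σ a₀, H.Adj w x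

/-- **The chain interior `R`**: the `Λ`-interior of `chainS` — its vertices all of whose `H`-neighbours
in `Λ` lie in `chainS` (the region on which the walk of the exit representation runs). -/
def chainR (H : SimpleGraph (Site 2)) (Λ : Finset (Site 2)) (δ : ℝ) (p : ℂ) (R σ : ℝ) (a₀ : Site 2) :
    Finset (Site 2) :=
  (chainS H Λ δ p R σ a₀).filter fun z => ∀ y ∈ Λ, H.Adj z y → y ∈ chainS H Λ δ p R σ a₀

/-- **The exit kernel** of the walk killed off `T`: `exitKernel H T u x = Σ_{w ∈ T, w ∼_H x} G_T(u, w)`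
(`G_T = greenEntry H T`), four times the probability that the walk from `u` leaves `T` through `x`. -/
def exitKernel (H : SimpleGraph (Site 2)) (T : Finset (Site 2)) (u x : Site 2) : ℝ :=
  ∑ w ∈ T.filter (fun w => H.Adj w x), greenEntry H T u w

/-! ## Unfolding lemmas -/

/-- Membership in `farTheta`, unfolded. -/
theorem mem_farTheta_iff {H : SimpleGraph (Site 2)} {Λ : Finset (Site 2)} {δ : ℝ} {p : ℂ} {R σ : ℝ}
    {v : Site 2} : v ∈ farTheta H Λ δ p R σ ↔ v ∈ Λ ∧ ¬ FarEscape H δ p R σ v := by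
  simp [farTheta]

/-- Membership in `farCluster`, unfolded. -/
theorem mem_farCluster_iff {H : SimpleGraph (Site 2)} {Λ : Finset (Site 2)} {δ : ℝ} {p : ℂ} {R σ : ℝ}
    {a₀ v : Site 2} : v ∈ farCluster H Λ δ p R σ a₀ ↔
      v ∈ Λ ∧ ∃ w : H.Walk a₀ v, ∀ z ∈ w.support, z ∈ farTheta H Λ δ p R σ := by
  simp [farCluster]

/-- Membership in `chainS`, unfolded. -/
theorem mem_chainS_iff {H : SimpleGraph (Site 2)} {Λ : Finset (Site 2)} {δ : ℝ} {p : ℂ} {R σ : ℝ}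
    {a₀ x : Site 2} : x ∈ chainS H Λ δ p R σ a₀ ↔
      x ∈ Λ ∧ (x ∈ farCluster H Λ δ p R σ a₀ ∨ ∃ w ∈ farCluster H Λ δ p R σ a₀, H.Adj w x) := by
  simp [chainS]

/-- Membership in `chainR`, unfolded. -/
theorem mem_chainR_iff {H : SimpleGraph (Site 2)} {Λ : Finset (Site 2)} {δ : ℝ} {p : ℂ} {R σ : ℝ}
    {a₀ z : Site 2} : z ∈ chainR H Λ δ p R σ a₀ ↔
      z ∈ chainS H Λ δ p R σ a₀ ∧ ∀ y ∈ Λ, H.Adj z y → y ∈ chainS H Λ δ p R σ a₀ := by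
  simp [chainR]

/-- `farTheta ⊆ Λ`. -/
theorem farTheta_subset {H : SimpleGraph (Site 2)} {Λ : Finset (Site 2)} {δ : ℝ} {p : ℂ} {R σ : ℝ} :
    farTheta H Λ δ p R σ ⊆ Λ := Finset.filter_subset _ _

/-- `farCluster ⊆ farTheta` (the endpoint of the joining walk lies in `Θ`). -/
theorem farCluster_subset_farTheta {H : SimpleGraph (Site 2)} {Λ : Finset (Site 2)} {δ : ℝ} {p : ℂ}
    {R σ : ℝ} {a₀ : Site 2} : farCluster H Λ δ p R σ a₀ ⊆ farTheta H Λ δ p R σ := by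
  intro v hv
  obtain ⟨-, w, hw⟩ := mem_farCluster_iff.1 hv
  exact hw v w.end_mem_support

/-- `chainR ⊆ chainS ⊆ Λ`. -/
theorem chainR_subset_chainS {H : SimpleGraph (Site 2)} {Λ : Finset (Site 2)} {δ : ℝ} {p : ℂ} {R σ : ℝ}
    {a₀ : Site 2} : chainR H Λ δ p R σ a₀ ⊆ chainS H Λ δ p R σ a₀ := Finset.filter_subset _ _

/-- `chainS ⊆ Λ`. -/
theorem chainS_subset {H : SimpleGraph (Site 2)} {Λ : Finset (Site 2)} {δ : ℝ} {p : ℂ} {R σ : ℝ}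
    {a₀ : Site 2} : chainS H Λ δ p R σ a₀ ⊆ Λ := Finset.filter_subset _ _

/-- A vertex of `Λ` inside the open ball `B(p, σ)` cannot far-escape: `Λ ∩ B(p, σ) ⊆ Θ(σ)`. -/
theorem mem_farTheta_of_dist_lt {H : SimpleGraph (Site 2)} {Λ : Finset (Site 2)} {δ : ℝ} {p : ℂ} {R σ : ℝ}
    {v : Site 2} (hv : v ∈ Λ) (hd : dist (meshPoint δ v) p < σ) : v ∈ farTheta H Λ δ p R σ := by
  refine mem_farTheta_iff.2 ⟨hv, ?_⟩
  rintro ⟨y, w, -, hw⟩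
  exact absurd (hw v w.start_mem_support) (not_le.2 hd)

/-- A vertex of `Θ(σ)` lies within `R` of `p` whenever `σ ≤ R` (otherwise the trivial walk far-escapes):
`Θ(σ) ⊆ B(p, R)` by definition. -/
theorem dist_lt_of_mem_farTheta : ∀ {H : SimpleGraph (Site 2)} {Λ : Finset (Site 2)} {δ : ℝ} {p : ℂ} {R σ : ℝ},
    σ ≤ R → ∀ {v : Site 2}, v ∈ farTheta H Λ δ p R σ → dist (meshPoint δ v) p < R := by
  intro H Λ δ p R σ hσR v hv
  by_contra h
  refine (mem_farTheta_iff.1 hv).2 ⟨v, SimpleGraph.Walk.nil, not_lt.1 h, ?_⟩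
  intro z hz
  rw [SimpleGraph.Walk.support_nil, List.mem_singleton] at hz
  subst hz
  exact hσR.trans (not_lt.1 h)

/-- The exit kernel is the sum defining it (unfolding lemma for rewriting under binders). -/
theorem exitKernel_eq {H : SimpleGraph (Site 2)} {T : Finset (Site 2)} {u x : Site 2} :
    exitKernel H T u x = ∑ w ∈ T.filter (fun w => H.Adj w x), greenEntry H T u w := rfl

end Summit.CriticalPhenomena.SAWScalingLimit.Theorems.AvoidanceLimit.Anchor

end
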